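import Summits.ABC.ABC.Theorems.TwistAmplificationSharpModerateLawDefs
import Literature.NumberTheory.EllipticCurves.SzpiroLocalDataProofs
import Literature.NumberTheory.EllipticCurves.SzpiroAbcCoreProofs

/-!
# Crux `TwistAmplification.SharpModerateLaw` (stmt-ABC-1975), line `syzygy-lattice-half-deep-few-primes`:
cusp coordinates of a reduced minimal model

Support for the transfer stub `stub_cuspTransfer : CuspTransfer` (file
`TwistAmplificationSharpModerateLawCuspTransfer.lean`): for an integral Weierstrass model `W`,
* `Mcusp (c₄, c₆) = max(|Δ|, |c₄|³)` exactly (`1728Δ = c₄³ − c₆²`, Mathlib's `c_relation`);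
* tower-freeness `TF (c₄, c₆)` of a model minimal at every place (the tree's
  `not_pow_dvd_c₄_c₆_of_isMinimalAt{,_two,_three}`, Silverman AEC Ex. 8.21);
* `N5cusp (c₄, c₆) ∣ N` for a model minimal at every place (conductor exponents `f_p ≥ 1` at `p ∣ Δ`,
  `f_p ≥ 2` at `p ∣ Δ, p ∣ c₄`, from the tree's `SzpiroLocalDataProofs`, B–G 12.5.9);
* `(a₁, a₂, a₃, c₄, c₆)` determine the model (`model_injective`);
* every cusp shell `cuspShell X Y` is finite (registered sub-goal `cuspShell_finite_holds`);
* a window model with `N ≤ X`, `N^κ ≤ M⁺` has `(c₄, c₆) ∈ cuspShell (min X 2^{(j+1)/κ}) 2^j`,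
  `j = ⌊log₂ M⁺⌋ ≤ ⌊log₂ ⌊X^σ⌋⌋` (`mem_cuspShell_of_window`, `log_Mcusp_le`).
-/

noncomputable section

namespace Summit.ABC.ABC.Theorems.SharpModerateLaw

open WeierstrassCurve IsDedekindDomain Rat.HeightOneSpectrum Real

/-! ## 1. Cusp coordinates of an integral model -/

section Model

variable (W : WeierstrassCurve ℤ)

/-- `c₄³ − c₆² = 1728Δ` (Mathlib's `c_relation`, reoriented). -/
theorem c₄_cube_sub_c₆_sq : W.c₄ ^ 3 - W.c₆ ^ 2 = 1728 * W.Δ := by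
  rw [W.c_relation]

/-- `(c₄³ − c₆²)/1728 = Δ` exactly. -/
theorem c₄_cube_sub_c₆_sq_ediv : (W.c₄ ^ 3 - W.c₆ ^ 2) / 1728 = W.Δ := by
  rw [c₄_cube_sub_c₆_sq]; simp

/-- `Mcusp (c₄, c₆) = max(|Δ|, |c₄|³)` as an integer. -/
theorem natCast_Mcusp_eq : ((Mcusp (W.c₄, W.c₆) : ℕ) : ℤ) = max |W.Δ| (|W.c₄| ^ 3) := by
  simp only [Mcusp, c₄_cube_sub_c₆_sq_ediv, Nat.cast_max, Nat.cast_pow, Int.natCast_natAbs]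

/-- `Mcusp (c₄, c₆) = max(|Δ|, |c₄|³)` as a real number. -/
theorem cast_Mcusp_eq : ((Mcusp (W.c₄, W.c₆) : ℕ) : ℝ) = ((max |W.Δ| (|W.c₄| ^ 3) : ℤ) : ℝ) := by
  rw [← natCast_Mcusp_eq]; simp

variable {W}

/-- Tower-freeness of `(c₄, c₆)` for a model minimal at every place (Silverman AEC Ex. 8.21, in the
tree as `not_pow_dvd_c₄_c₆_of_isMinimalAt{,_two,_three}`). -/
theorem tf_of_isMinimalAt (hΔ : W.Δ ≠ 0) (hmin : ∀ v : HeightOneSpectrum ℤ, (W.baseChange ℚ).IsMinimalAt v) :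
    TF (W.c₄, W.c₆) := by
  refine ⟨fun p hp h5 => ?_, ?_, ?_⟩
  · have h := not_pow_dvd_c₄_c₆_of_isMinimalAt ((primesEquiv (R := ℤ)).symm ⟨p, hp⟩) W hΔ (hmin _)
    rw [Literature.NumberTheory.EllipticCurves.Rat.natGenerator_primesEquiv_symm] at h
    exact h h5
  · have h := not_pow_dvd_c₄_c₆_of_isMinimalAt_two ((primesEquiv (R := ℤ)).symm ⟨2, Nat.prime_two⟩) W hΔ
      (hmin _)
    rw [Literature.NumberTheory.EllipticCurves.Rat.natGenerator_primesEquiv_symm] at h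
    exact h rfl
  · have h := not_pow_dvd_c₄_c₆_of_isMinimalAt_three ((primesEquiv (R := ℤ)).symm ⟨3, Nat.prime_three⟩) W
      hΔ (hmin _)
    rw [Literature.NumberTheory.EllipticCurves.Rat.natGenerator_primesEquiv_symm] at h
    exact h rfl

/-- **The conductor proxy divides the conductor**: for a model minimal at every place,
`N5cusp (c₄, c₆) ∣ N` (`f_p ≥ 1` at `p ∣ Δ`, `f_p ≥ 2` at `p ∣ Δ`, `p ∣ c₄`; B–G 12.5.9). -/
theorem n5cusp_dvd_conductorNorm [(W.baseChange ℚ).IsElliptic]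
    (hmin : ∀ v : HeightOneSpectrum ℤ, (W.baseChange ℚ).IsMinimalAt v) :
    N5cusp (W.c₄, W.c₆) ∣ (W.baseChange ℚ).conductorNorm ℤ := by
  have hN0 : (W.baseChange ℚ).conductorNorm ℤ ≠ 0 := (conductorNorm_pos_holds _).ne'
  unfold N5cusp
  simp only [c₄_cube_sub_c₆_sq_ediv]
  have hconv : ∀ p ∈ (W.Δ.natAbs.primeFactors.filter fun p => 5 ≤ p),
      (if ((p : ℕ) : ℤ) ∣ W.c₄ then p ^ 2 else p) = p ^ (if ((p : ℕ) : ℤ) ∣ W.c₄ then 2 else 1) := by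
    intro p _
    split_ifs <;> simp
  rw [Finset.prod_congr rfl hconv]
  refine Literature.NumberTheory.EllipticCurves.SzpiroOfAbc.prod_prime_pow_dvd
    (fun p hp => Nat.prime_of_mem_primeFactors (Finset.mem_filter.mp hp).1) _ ?_
  intro p hp
  obtain ⟨hpF, -⟩ := Finset.mem_filter.mp hp
  have hpp : p.Prime := Nat.prime_of_mem_primeFactors hpF
  have hpΔ : (p : ℤ) ∣ W.Δ := Int.ofNat_dvd_left.mpr (Nat.dvd_of_mem_primeFactors hpF)
  set v : HeightOneSpectrum ℤ := (primesEquiv (R := ℤ)).symm ⟨p, hpp⟩ with hv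
  have hgen : natGenerator v = p :=
    Literature.NumberTheory.EllipticCurves.Rat.natGenerator_primesEquiv_symm ⟨p, hpp⟩
  have hfac : ((W.baseChange ℚ).conductorNorm ℤ).factorization p = (W.baseChange ℚ).conductorExponent v :=
    factorization_conductorNorm_primesEquiv_symm _ ⟨p, hpp⟩
  refine (hpp.pow_dvd_iff_le_factorization hN0).mpr ?_
  rw [hfac]
  split_ifs with hc
  · exact two_le_conductorExponent_of_dvd_Δ_of_dvd_c₄ (hmin v) (by rw [hgen]; exact hpΔ)
      (by rw [hgen]; exact hc)
  · exact Nat.one_le_iff_ne_zero.mpr (conductorExponent_ne_zero_of_dvd_Δ (hmin v) (by rw [hgen]; exact hpΔ))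

/-- `(a₁, a₂, a₃, c₄, c₆)` determine an integral Weierstrass model. -/
theorem model_injective : Function.Injective
    fun W : WeierstrassCurve ℤ => ((W.a₁, W.a₂, W.a₃), (W.c₄, W.c₆)) := by
  intro W W' h
  simp only [Prod.mk.injEq] at h
  obtain ⟨⟨h1, h2, h3⟩, h4, h6⟩ := h
  obtain ⟨a₁, a₂, a₃, a₄, a₆⟩ := W
  obtain ⟨a₁', a₂', a₃', a₄', a₆'⟩ := W'
  simp only at h1 h2 h3 h4 h6
  subst h1 h2 h3
  simp only [WeierstrassCurve.c₄, WeierstrassCurve.c₆, WeierstrassCurve.b₂, WeierstrassCurve.b₄,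
    WeierstrassCurve.b₆] at h4 h6
  have ha₄ : a₄ = a₄' := by linarith
  subst ha₄
  have ha₆ : a₆ = a₆' := by linarith
  subst ha₆
  rfl

end Model

/-! ## 2. Finiteness of the cusp shells -/

section Shell

/-- The cusp shell at level `Y` is finite (`|c₄|³ < 2Y` and `c₆² ≤ |c₄|³ + 3456 Y`). -/
theorem cuspShell_finite (X Y : ℝ) : (cuspShell X Y).Finite := by
  set Y' : ℝ := max Y 1 with hY'
  have hY'1 : (1 : ℝ) ≤ Y' := le_max_right _ _
  have hYY' : Y ≤ Y' := le_max_left _ _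
  have hT : (1 : ℝ) ≤ 3458 * Y' := by linarith
  set N : ℕ := Nat.ceil (3458 * Y') with hN
  have hTN : 3458 * Y' ≤ N := Nat.le_ceil _
  refine (Set.Finite.prod (Set.finite_Icc (-(N : ℤ)) N) (Set.finite_Icc (-(N : ℤ)) N)).subset ?_
  rintro ⟨x, y⟩ ⟨-, -, -, hdvd, -, -, hM, -⟩
  simp only [Set.mem_prod, Set.mem_Icc]
  have hM' : ((Mcusp (x, y) : ℕ) : ℝ) < 2 * Y' := hM.trans_le (by linarith)
  have hx3 : ((x.natAbs ^ 3 : ℕ) : ℝ) < 2 * Y' :=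
    lt_of_le_of_lt (by exact_mod_cast le_max_right _ _) hM'
  have hq : ((((x ^ 3 - y ^ 2) / 1728).natAbs : ℕ) : ℝ) < 2 * Y' :=
    lt_of_le_of_lt (by exact_mod_cast le_max_left _ _) hM'
  obtain ⟨k, hk⟩ := hdvd
  have hk' : (x ^ 3 - y ^ 2) / 1728 = k := by rw [hk]; simp
  rw [hk'] at hq
  have hxR : |(x : ℝ)| ^ 3 < 2 * Y' := by
    have : ((x.natAbs ^ 3 : ℕ) : ℝ) = |(x : ℝ)| ^ 3 := by push_cast; rw [Nat.cast_natAbs, Int.cast_abs]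
    rwa [this] at hx3
  have hkR : |(k : ℝ)| < 2 * Y' := by
    have : ((k.natAbs : ℕ) : ℝ) = |(k : ℝ)| := by rw [Nat.cast_natAbs, Int.cast_abs]
    rwa [this] at hq
  have hxy : (x : ℝ) ^ 3 - (y : ℝ) ^ 2 = 1728 * k := by exact_mod_cast hk
  -- `|x|³ ≤ T`, `T ≥ 1` ⇒ `|x| ≤ T`; `y² ≤ T`, `T ≥ 1` ⇒ `|y| ≤ T`
  have cube_le : ∀ {z : ℝ}, |z| ^ 3 ≤ 3458 * Y' → |z| ≤ 3458 * Y' := by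
    intro z h
    rcases le_or_gt |z| 1 with h1 | h1
    · exact h1.trans hT
    · have h2 : 0 ≤ |z| * (|z| ^ 2 - 1) := mul_nonneg (abs_nonneg _) (by nlinarith)
      nlinarith [h2]
  have sq_le : ∀ {z : ℝ}, z ^ 2 ≤ 3458 * Y' → |z| ≤ 3458 * Y' := by
    intro z h
    rcases le_or_gt |z| 1 with h1 | h1
    · exact h1.trans hT
    · have h2 : 0 ≤ |z| * (|z| - 1) := mul_nonneg (abs_nonneg _) (by linarith)
      have h3 : |z| ^ 2 = z ^ 2 := sq_abs z
      nlinarith [h2, h3]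
  have hx' : |(x : ℝ)| ≤ N := (cube_le (by linarith)).trans hTN
  have hy2 : (y : ℝ) ^ 2 ≤ 3458 * Y' := by
    have h2 : (x : ℝ) ^ 3 ≤ |(x : ℝ)| ^ 3 := by rw [← abs_pow]; exact le_abs_self _
    have h5 := (abs_lt.mp hkR).1
    nlinarith
  have hy' : |(y : ℝ)| ≤ N := (sq_le hy2).trans hTN
  have hx'' : |x| ≤ (N : ℤ) := by exact_mod_cast hx'
  have hy'' : |y| ≤ (N : ℤ) := by exact_mod_cast hy'
  exact ⟨⟨(abs_le.mp hx'').1, (abs_le.mp hx'').2⟩, ⟨(abs_le.mp hy'').1, (abs_le.mp hy'').2⟩⟩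

/-- Registered sub-goal `cuspShell_finite_holds` of stmt-ABC-1975: every cusp shell is finite, so the
`Set.ncard` in `CuspShellLaw` is an honest count. -/
theorem cuspShell_finite_holds : ∀ X Y : ℝ, (cuspShell X Y).Finite := cuspShell_finite

end Shell

/-! ## 3. A window model lands in a dyadic cusp shell -/

section Window

variable {W : WeierstrassCurve ℤ}

/-- For a reduced minimal model in the window (`N ≤ X`, `N^κ ≤ M⁺`), with `j = ⌊log₂ M⁺⌋`:
`(c₄, c₆) ∈ cuspShell (min X 2^{(j+1)/κ}) 2^j`. -/
theorem mem_cuspShell_of_window {κ X : ℝ} (hκ : 0 < κ) [(W.baseChange ℚ).IsElliptic]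
    (hmin : ∀ v : HeightOneSpectrum ℤ, (W.baseChange ℚ).IsMinimalAt v) (hc₄ : W.c₄ ≠ 0) (hc₆ : W.c₆ ≠ 0)
    (hNX : (((W.baseChange ℚ).conductorNorm ℤ : ℕ) : ℝ) ≤ X)
    (hlo : (((W.baseChange ℚ).conductorNorm ℤ : ℕ) : ℝ) ^ κ ≤ ((max |W.Δ| (|W.c₄| ^ 3) : ℤ) : ℝ)) :
    (W.c₄, W.c₆) ∈ cuspShell (min X ((2 : ℝ) ^ (((Nat.log 2 (Mcusp (W.c₄, W.c₆)) + 1 : ℕ) : ℝ) / κ)))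
      ((2 : ℝ) ^ Nat.log 2 (Mcusp (W.c₄, W.c₆))) := by
  have hΔ : W.Δ ≠ 0 := Δ_ne_zero_of_isElliptic_baseChange_int W
  set x : ℤ × ℤ := (W.c₄, W.c₆) with hx
  set j : ℕ := Nat.log 2 (Mcusp x) with hj
  set N : ℕ := (W.baseChange ℚ).conductorNorm ℤ with hN
  have hM0 : Mcusp x ≠ 0 := by
    have h1 : 1 ≤ W.c₄.natAbs ^ 3 := Nat.one_le_pow _ _ (Int.natAbs_pos.mpr hc₄)
    have h2 : W.c₄.natAbs ^ 3 ≤ Mcusp x := le_max_right _ _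
    omega
  have hlow : (2 : ℝ) ^ j ≤ (Mcusp x : ℝ) := by exact_mod_cast Nat.pow_log_le_self 2 hM0
  have hupp : (Mcusp x : ℝ) < 2 * (2 : ℝ) ^ j := by
    have := Nat.lt_pow_succ_log_self (b := 2) (by norm_num) (Mcusp x)
    have h' : ((Mcusp x : ℕ) : ℝ) < ((2 ^ (j + 1) : ℕ) : ℝ) := by exact_mod_cast this
    simpa [pow_succ, mul_comm] using h'
  have hMreal : ((Mcusp x : ℕ) : ℝ) = ((max |W.Δ| (|W.c₄| ^ 3) : ℤ) : ℝ) := cast_Mcusp_eq W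
  have hN1 : (1 : ℝ) ≤ (N : ℝ) := by exact_mod_cast conductorNorm_pos_holds (W.baseChange ℚ)
  have hN0 : (0 : ℝ) ≤ (N : ℝ) := by linarith
  -- `N ≤ 2^{(j+1)/κ}` from `N^κ ≤ M⁺ < 2^{j+1}`
  have hNκ : (N : ℝ) ^ κ < (2 : ℝ) ^ (((j + 1 : ℕ) : ℝ)) := by
    rw [Real.rpow_natCast, pow_succ, mul_comm]
    exact lt_of_le_of_lt (hlo.trans_eq hMreal.symm) hupp
  have hNle : (N : ℝ) ≤ (2 : ℝ) ^ (((j + 1 : ℕ) : ℝ) / κ) := by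
    have h1 : ((N : ℝ) ^ κ) ^ (1 / κ) ≤ ((2 : ℝ) ^ (((j + 1 : ℕ) : ℝ))) ^ (1 / κ) :=
      Real.rpow_le_rpow (Real.rpow_nonneg hN0 κ) hNκ.le (by positivity)
    rw [← Real.rpow_mul hN0, mul_one_div_cancel hκ.ne', Real.rpow_one, ← Real.rpow_mul (by norm_num)] at h1
    rwa [div_eq_mul_one_div]
  have hN5 : (N5cusp x : ℝ) ≤ (N : ℝ) := by
    have h := Nat.le_of_dvd (conductorNorm_pos_holds (W.baseChange ℚ)) (n5cusp_dvd_conductorNorm hmin)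
    exact_mod_cast h
  refine ⟨hc₄, hc₆, ?_, ⟨W.Δ, by rw [c₄_cube_sub_c₆_sq]⟩, tf_of_isMinimalAt hΔ hmin, hlow, hupp, ?_⟩
  · intro h
    have : (1728 : ℤ) * W.Δ = 0 := by rw [← c₄_cube_sub_c₆_sq, h, sub_self]
    exact hΔ (by simpa using this)
  · exact le_min (hN5.trans hNX) (hN5.trans hNle)

/-- The shell index of a window model is at most `⌊log₂ ⌊X^σ⌋⌋` (`M⁺ ≤ N^σ ≤ X^σ`). -/
theorem log_Mcusp_le {σ X : ℝ} (hσ : 0 ≤ σ) [(W.baseChange ℚ).IsElliptic]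
    (hNX : (((W.baseChange ℚ).conductorNorm ℤ : ℕ) : ℝ) ≤ X)
    (hhi : ((max |W.Δ| (|W.c₄| ^ 3) : ℤ) : ℝ) ≤ (((W.baseChange ℚ).conductorNorm ℤ : ℕ) : ℝ) ^ σ) :
    Nat.log 2 (Mcusp (W.c₄, W.c₆)) ≤ Nat.log 2 ⌊X ^ σ⌋₊ := by
  apply Nat.log_mono_right
  apply Nat.le_floor
  rw [cast_Mcusp_eq]
  have hN0 : (0 : ℝ) ≤ (((W.baseChange ℚ).conductorNorm ℤ : ℕ) : ℝ) := Nat.cast_nonneg _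
  exact hhi.trans (Real.rpow_le_rpow hN0 hNX hσ)

end Window

end Summit.ABC.ABC.Theorems.SharpModerateLaw

end
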